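import Summits.NavierStokesRegularity.NavierStokesRegularity.Theorems.ExtremiserTransienceWeakClassGradTypeI
import Literature.Analysis.FluidPDE.GigaMiura2011ScaledAlignmentBlowupLimitHolds
import Literature.Analysis.FluidPDE.TypeIAncientMild
import Literature.Analysis.FluidPDE.TypeIAncientMildClassical
import HarnessLib

/-!
# Route `ExtremiserTransience`, LINE g5-α repair (seat ns-idea-5 g5): the weak one-slice class IS the literature class `IsTypeIAncientMild`

`--supports stmt-NavierStokesRegularity-27823` (`PlateauSliceRigidity`, reduced to the Type-I ancient local energy budget by
`plateauSliceRigidity_of_budget`, p636343).  The three clauses of the weak one-slice class of 27823 — joint continuity on `(−∞,0) × ℝ³`, the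
Oseen identity `W t = heatFlow (W s) (t − s) − oseenDuhamel 1 s W W t` between all negative times, and the Type-I bound `√(−t)‖W t x‖ ≤ K` — imply
the tree's `Literature.Analysis.FluidPDE.IsTypeIAncientMild K W` (KNSS 2009 §4/§6 gauge class: jointly `C^∞`, divergence-free slices, Oseen-mild,
`‖W t x‖ ≤ K/√(−t)`).  Joint smoothness is KNSS Prop. 4.1 on bounded windows (`contDiffOn_of_bounded_oseenMild`, applied to the time-shifted field,
which is bounded); divergence-freeness is the landed `weakClass_isDivFree`.  CONSEQUENCE for the budget prover: every window `(t₀, 0)` carries a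
smooth pressure making `(W, q)` a classical unit-viscosity Navier–Stokes solution (`IsTypeIAncientMild.exists_isClassicalNSSolutionOn_Ioo`), so the
tree's classical local energy identity (`IsClassicalNSSolutionOn.local_energy_identity_cutoff`) and the Oseen-mild pressure identification
(`pressure_eq_pressurePotentialMod_add_const_of_oseenMild`) apply verbatim.  HONEST FRAMING: regularity bookkeeping for hypothetical blow-up
limits; nothing about Navier–Stokes regularity or blow-up is proved here and no summit is proved by a line.
[cite: KochNadirashviliSereginSverak2009, Prop. 4.1 and §6 (arXiv:0709.3599 pp. 8, 11)]
-/

noncomputable section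

namespace Summit.NavierStokesRegularity.NavierStokesRegularity.Theorems.ExtremiserTransience
set_option linter.dupNamespace false

open Set Function MeasureTheory Filter Topology
open scoped RealInnerProductSpace ContDiff
open Literature.Analysis Literature.Analysis.FluidPDE

/-- **The weak one-slice class is `IsTypeIAncientMild`.** [cite: KochNadirashviliSereginSverak2009, Prop. 4.1 and §6 (arXiv:0709.3599 pp. 8, 11)] -/
theorem weakClass_isTypeIAncientMild (W : ℝ → EuclideanSpace ℝ (Fin 3) → EuclideanSpace ℝ (Fin 3)) (K : ℝ)
    (hcont : ContinuousOn (Function.uncurry W) (Set.Iio (0 : ℝ) ×ˢ Set.univ))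
    (hmild : ∀ s t : ℝ, s < t → t < 0 → ∀ x, W t x =
      Literature.Analysis.FluidPDE.heatFlow (W s) (t - s) x - Literature.Analysis.FluidPDE.oseenDuhamel 1 s W W t x)
    (hdec : ∀ t : ℝ, t < 0 → ∀ x, Real.sqrt (-t) * ‖W t x‖ ≤ K) :
    IsTypeIAncientMild K W := by
  have hwdiv := weakClass_isWeaklyDivFree W K hcont hmild hdec
  -- the Oseen identity in `heatExtension` form
  have hmildE : ∀ s t : ℝ, s < t → t < 0 → ∀ x,
      W t x = UnboundedOperators.heatExtension (W s) (t - s) x - oseenDuhamel 1 s W W t x := by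
    intro s t hst ht x
    rw [← heatFlow_of_pos _ (sub_pos.2 hst)]
    exact hmild s t hst ht x
  -- ### joint smoothness: KNSS Prop. 4.1 on the shifted (hence bounded) fields `V_b τ = W (τ + b)`, `b < 0`
  have hsmooth : ContDiffOn ℝ (⊤ : ℕ∞) (uncurry W) (Iio 0 ×ˢ univ) := by
    refine contDiffOn_of_locally_contDiffOn ?_
    rintro ⟨t, x⟩ ⟨ht, -⟩
    have ht0 : t < 0 := ht
    set b : ℝ := t / 2 with hb
    have hb0 : b < 0 := by rw [hb]; linarith
    set A : ℝ := t / 2 - 1 with hA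
    -- the shifted field on `(A, 0)`
    set V : ℝ → EuclideanSpace ℝ (Fin 3) → EuclideanSpace ℝ (Fin 3) := fun τ => W (τ - (-b)) with hV
    have hVt : ∀ τ, τ < 0 → τ - (-b) < 0 := fun τ hτ => by linarith
    have hVc : ContinuousOn (uncurry V) (Ioo A 0 ×ˢ univ) := by
      have hmap : Continuous fun q : ℝ × EuclideanSpace ℝ (Fin 3) => (q.1 - (-b), q.2) :=
        (continuous_fst.sub continuous_const).prodMk continuous_snd
      have hinto : MapsTo (fun q : ℝ × EuclideanSpace ℝ (Fin 3) => (q.1 - (-b), q.2))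
          (Ioo A 0 ×ˢ univ) (Iio 0 ×ˢ univ) := fun q hq => ⟨hVt q.1 hq.1.2, mem_univ _⟩
      exact (hcont.comp hmap.continuousOn hinto).congr fun q _ => rfl
    have hVdiv : ∀ τ ∈ Ioo A 0, IsWeaklyDivFree (V τ) := fun τ hτ => hwdiv _ (hVt τ hτ.2)
    have hVmild : ∀ s τ : ℝ, A < s → s < τ → τ < 0 → ∀ y,
        V τ y = UnboundedOperators.heatExtension (V s) (τ - s) y - oseenDuhamel 1 s V V τ y := by
      intro s τ _ hsτ hτ y
      show W (τ - (-b)) y = UnboundedOperators.heatExtension (W (s - (-b))) (τ - s) y -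
        oseenDuhamel 1 s (fun σ => W (σ - (-b))) (fun σ => W (σ - (-b))) τ y
      rw [oseenDuhamel_comp_sub_right, show τ - s = τ - (-b) - (s - (-b)) by ring]
      exact hmildE _ _ (by linarith) (hVt τ hτ) y
    have hVbd : ∀ τ ∈ Ioo A 0, ∀ y, ‖V τ y‖ ≤ K / Real.sqrt (-b) := by
      intro τ hτ y
      have hτb : τ - (-b) < 0 := hVt τ hτ.2
      have hsq : 0 < Real.sqrt (-(τ - (-b))) := Real.sqrt_pos.2 (by linarith)
      have h1 : ‖W (τ - (-b)) y‖ ≤ K / Real.sqrt (-(τ - (-b))) := by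
        rw [le_div_iff₀ hsq, mul_comm]; exact hdec _ hτb y
      have hK : 0 ≤ K := le_trans (mul_nonneg hsq.le (norm_nonneg _)) (hdec _ hτb y)
      have h2 : Real.sqrt (-b) ≤ Real.sqrt (-(τ - (-b))) := Real.sqrt_le_sqrt (by linarith [hτ.2])
      exact h1.trans (div_le_div_of_nonneg_left hK (Real.sqrt_pos.2 (by linarith)) h2)
    have hVs := contDiffOn_of_bounded_oseenMild hVc hVdiv hVmild hVbd
    -- transport back along `t ↦ t + (-b)`: `uncurry W = uncurry V ∘ (t, x) ↦ (t + (-b), x)` near `(t, x)`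
    refine ⟨Ioo (A - (-b)) (-(-b)) ×ˢ univ, isOpen_Ioo.prod isOpen_univ,
      ⟨⟨by rw [hA]; linarith, by linarith⟩, mem_univ _⟩, ?_⟩
    have hmap : ContDiff ℝ ((⊤ : ℕ∞) : WithTop ℕ∞) fun q : ℝ × EuclideanSpace ℝ (Fin 3) => (q.1 + (-b), q.2) :=
      (contDiff_fst.add contDiff_const).prodMk contDiff_snd
    have hinto : MapsTo (fun q : ℝ × EuclideanSpace ℝ (Fin 3) => (q.1 + (-b), q.2))
        ((Iio 0 ×ˢ univ) ∩ Ioo (A - (-b)) (-(-b)) ×ˢ univ) (Ioo A 0 ×ˢ univ) := by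
      rintro ⟨τ, y⟩ ⟨-, hτ, -⟩
      exact ⟨⟨by linarith [hτ.1], by linarith [hτ.2]⟩, mem_univ _⟩
    refine ((hVs.comp hmap.contDiffOn hinto).congr ?_)
    rintro ⟨τ, y⟩ _
    simp [hV]
  -- ### the class
  refine ⟨hsmooth, fun t ht => weakClass_isDivFree W K hcont hmild hdec t ht, hmild, fun t ht x => ?_⟩
  have hsq : 0 < Real.sqrt (-t) := Real.sqrt_pos.2 (neg_pos.2 ht)
  rw [le_div_iff₀ hsq, mul_comm]
  exact hdec t ht x

/-- **Consequence: a classical pressure on every window.** Every member of the weak one-slice class is, with some smooth pressure, a classical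
unit-viscosity Navier–Stokes solution on `(t₀, 0)` for every `t₀ < 0`. [cite: FabesJonesRiviere1972, Thm. 2.1] -/
theorem weakClass_exists_classical_window (W : ℝ → EuclideanSpace ℝ (Fin 3) → EuclideanSpace ℝ (Fin 3)) (K : ℝ)
    (hcont : ContinuousOn (Function.uncurry W) (Set.Iio (0 : ℝ) ×ˢ Set.univ))
    (hmild : ∀ s t : ℝ, s < t → t < 0 → ∀ x, W t x =
      Literature.Analysis.FluidPDE.heatFlow (W s) (t - s) x - Literature.Analysis.FluidPDE.oseenDuhamel 1 s W W t x)
    (hdec : ∀ t : ℝ, t < 0 → ∀ x, Real.sqrt (-t) * ‖W t x‖ ≤ K) {t₀ : ℝ} (ht₀ : t₀ < 0) :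
    ∃ q : ℝ → EuclideanSpace ℝ (Fin 3) → ℝ, IsClassicalNSSolutionOn (Set.Ioo t₀ 0) 1 0 W q :=
  (weakClass_isTypeIAncientMild W K hcont hmild hdec).exists_isClassicalNSSolutionOn_Ioo ht₀

end Summit.NavierStokesRegularity.NavierStokesRegularity.Theorems.ExtremiserTransience
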